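import Literature.Barriers.CriticalPhenomena.LaceExpansionXSpaceKernelNorms
import HarnessLib

/-!
# Picking the two long lines of a chain of pair kernels (Hara 2008, §3.5): the two-strand
# pigeonhole as a pointwise induction along the chain — PROVED (generic)

Barrier catalogue `Literature/Barriers/CriticalPhenomena/` (D-0021), infrastructure for the
conditional reduction of `Hara2008_twoLongLinesDiagramBoundPc` (`LaceExpansionXSpaceLemma15Diagrams.lean`).
Hara: "We have a segment of length `≥ |x|/(2N+1)` on the upper and lower sides of the diagram
connecting `0` and `x`. These long segments can be any lines which lie on the upper and lower
sides of the diagram, so the total number of choices are bounded by `(2N+1)²`." For a chain of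
pair kernels `v X₁ ⋯ X_M e` (row vector, kernels, end vector; all `[0, ∞]`-valued) in which two
strands are read off by READERS `φ₁, φ₂ : α × α → α` (the position of the strand's vertex in each
pair), each stage `X_j` carrying `c₁` lines of strand 1 and `c₂` lines of strand 2, we are given for
every stage MARKED VARIANTS: kernels dominating `X_j` whenever the strand-1 displacement across the
stage is at least `c₁ r` (so that one of its `c₁` lines is `≥ r` long), similarly for strand 2, and
doubly marked variants (`MStage`, `MStage.Valid`). The conclusion (`tsum_M0_mul_le`): if the total
displacement `x - x₀` of both strands is at least (total count) `· r`, then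
`Σ_p (v X₁⋯X_M)(p) e(p)` is at most the sum of all chains carrying one strand-1 mark and one
strand-2 mark (`MState.M12` and the three end-marked terms). The proof is a pointwise induction
along the chain with four accumulators (unmarked, strand-1 marked, strand-2 marked, doubly marked;
`mStep`, `mRun`, `MState.Inv`): by the triangle inequality for `nrm`, if the strand has come at
least `(C + c) r` far at the output pair, then either it had come `C r` far at the input pair or
the stage displacement is `≥ c r`. Finally the accumulators are expanded into explicit lists of
singly/doubly marked chains (`L1`, `L2`, `L12`, `mRun_M12_eq` &c.), whose members are chains with
one or two kernels replaced (`mem_L1_iff` &c.), ready to be bounded one by one.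

Generic over an additive commutative group `α` and any subadditive `nrm : α → ℝ`.

## References

* T. Hara, Ann. Probab. 36 (2008) 530–593 (arXiv:math-ph/0504021): §3.5 ("picking long
  segments"; "(2N+1)² choices") and §3.4 (Step 1).
* M. Heydenreich, R. van der Hofstad, *Progress in High-Dimensional Percolation and Random
  Graphs*, Springer 2017: §7.5 ("a sequence of 2N+1 two-point functions … such that the sum of
  the displacements … is exactly equal to x").
-/

noncomputable section

open scoped ENNReal

namespace Literature.Barriers.CriticalPhenomena

variable {α : Type*}

/-! ### Sums of lists of kernels and of row vectors -/

/-- Pointwise sum of a list of kernels. [folklore] -/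
def lksum (L : List (α × α → α × α → ℝ≥0∞)) (p q : α × α) : ℝ≥0∞ := (L.map fun M => M p q).sum

/-- Pointwise sum of a list of row vectors. [folklore] -/
def lvsum (L : List (α × α → ℝ≥0∞)) (p : α × α) : ℝ≥0∞ := (L.map fun w => w p).sum

/-- Unfolding of `lksum` on `nil`. [folklore] -/
@[simp] theorem lksum_nil (p q : α × α) : lksum ([] : List (α × α → α × α → ℝ≥0∞)) p q = 0 := rfl

/-- Unfolding of `lksum` on `cons`. [folklore] -/
@[simp] theorem lksum_cons (M : α × α → α × α → ℝ≥0∞) (L : List (α × α → α × α → ℝ≥0∞)) (p q : α × α) :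
    lksum (M :: L) p q = M p q + lksum L p q := rfl

/-- Unfolding of `lvsum` on `nil`. [folklore] -/
@[simp] theorem lvsum_nil (p : α × α) : lvsum ([] : List (α × α → ℝ≥0∞)) p = 0 := rfl

/-- Unfolding of `lvsum` on `cons`. [folklore] -/
@[simp] theorem lvsum_cons (w : α × α → ℝ≥0∞) (L : List (α × α → ℝ≥0∞)) (p : α × α) :
    lvsum (w :: L) p = w p + lvsum L p := rfl

/-- `lvsum` of a concatenation. [folklore] -/
theorem lvsum_append (L L' : List (α × α → ℝ≥0∞)) (p : α × α) :
    lvsum (L ++ L') p = lvsum L p + lvsum L' p := by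
  induction L with
  | nil => simp
  | cons w L ih => simp [ih, add_assoc]

/-- `Σ_p (lvsum L)(p) f(p) = Σ_{w ∈ L} Σ_p w(p) f(p)`. [folklore] -/
theorem tsum_lvsum_mul (L : List (α × α → ℝ≥0∞)) (f : α × α → ℝ≥0∞) :
    ∑' p, lvsum L p * f p = (L.map fun w => ∑' p, w p * f p).sum := by
  induction L with
  | nil => simp
  | cons w L ih =>
    simp only [lvsum_cons, List.map_cons, List.sum_cons, add_mul]
    rw [ENNReal.tsum_add, ih]

/-- A sum over a list is at most its length times a uniform bound. [folklore] -/
theorem list_sum_le_length_mul {L : List ℝ≥0∞} {B : ℝ≥0∞} (h : ∀ a ∈ L, a ≤ B) : L.sum ≤ L.length * B := by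
  induction L with
  | nil => simp
  | cons a L ih =>
    rw [List.sum_cons, List.length_cons, Nat.cast_succ, add_mul, one_mul, add_comm (↑L.length * B)]
    exact add_le_add (h a (by simp)) (ih fun b hb => h b (by simp [hb]))

/-- `pkVmul` is additive in the row vector. [folklore] -/
theorem pkVmul_add (u u' : α × α → ℝ≥0∞) (X : α × α → α × α → ℝ≥0∞) :
    pkVmul (fun p => u p + u' p) X = fun q => pkVmul u X q + pkVmul u' X q := by
  funext q
  simp only [pkVmul, add_mul]
  exact ENNReal.tsum_add

/-- `pkVmul` is additive in the kernel. [folklore] -/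
theorem pkVmul_add_kernel (u : α × α → ℝ≥0∞) (X Y : α × α → α × α → ℝ≥0∞) :
    pkVmul u (fun p q => X p q + Y p q) = fun q => pkVmul u X q + pkVmul u Y q := by
  funext q
  simp only [pkVmul, mul_add]
  exact ENNReal.tsum_add

/-- `pkVmul` of the zero row vector. [folklore] -/
theorem pkVmul_zero (X : α × α → α × α → ℝ≥0∞) : pkVmul (fun _ => 0) X = fun _ => 0 := by
  funext q; simp [pkVmul]

/-- `pkVmul` against a sum of kernels. [folklore] -/
theorem pkVmul_lksum (u : α × α → ℝ≥0∞) (L : List (α × α → α × α → ℝ≥0∞)) :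
    pkVmul u (lksum L) = lvsum (L.map fun M => pkVmul u M) := by
  induction L with
  | nil => funext q; simp [pkVmul, lksum, lvsum]
  | cons M L ih =>
    have : lksum (M :: L) = fun p q => M p q + lksum L p q := rfl
    rw [this, pkVmul_add_kernel, ih]
    rfl

/-- Left chains are additive in the row vector. [folklore] -/
theorem pkChainL_add (u u' : α × α → ℝ≥0∞) (Ks : List (α × α → α × α → ℝ≥0∞)) :
    pkChainL (fun p => u p + u' p) Ks = fun q => pkChainL u Ks q + pkChainL u' Ks q := by
  induction Ks generalizing u u' with
  | nil => rfl
  | cons K Ks ih => rw [pkChainL_cons, pkVmul_add, ih]; rfl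

/-- Left chain of the zero row vector. [folklore] -/
theorem pkChainL_zero (Ks : List (α × α → α × α → ℝ≥0∞)) : pkChainL (fun _ => (0 : ℝ≥0∞)) Ks = fun _ => 0 := by
  induction Ks with
  | nil => rfl
  | cons K Ks ih => rw [pkChainL_cons, pkVmul_zero, ih]

/-- Left chains of a sum of row vectors. [folklore] -/
theorem pkChainL_lvsum (L : List (α × α → ℝ≥0∞)) (Ks : List (α × α → α × α → ℝ≥0∞)) :
    pkChainL (lvsum L) Ks = lvsum (L.map fun w => pkChainL w Ks) := by
  induction L with
  | nil => exact pkChainL_zero Ks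
  | cons w L ih =>
    have : lvsum (w :: L) = fun p => w p + lvsum L p := rfl
    rw [this, pkChainL_add, ih]
    rfl

/-! ### Stages with marked variants, and the four-accumulator run -/

/-- A **stage** of a chain with two strands: the kernel `K`, the readers `φ₁, φ₂` of the two strands
on the OUTPUT pair, the numbers `c₁, c₂` of lines of each strand inside the stage, and the marked
variants: `K1` (one strand-1 line marked long), `K2`, `K12` (one line of each strand marked).
[cite: Hara2008, §3.5 ("these long segments can be any lines which lie on the upper and lower sides")] -/
structure MStage (α : Type*) where
  /-- the kernel of the stage -/
  K : α × α → α × α → ℝ≥0∞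
  /-- reader of strand 1 on the output pair -/
  φ₁ : α × α → α
  /-- reader of strand 2 on the output pair -/
  φ₂ : α × α → α
  /-- number of strand-1 lines in the stage -/
  c₁ : ℕ
  /-- number of strand-2 lines in the stage -/
  c₂ : ℕ
  /-- variants with one strand-1 line marked -/
  K1 : List (α × α → α × α → ℝ≥0∞)
  /-- variants with one strand-2 line marked -/
  K2 : List (α × α → α × α → ℝ≥0∞)
  /-- variants with one line of each strand marked -/
  K12 : List (α × α → α × α → ℝ≥0∞)

section Run

variable [AddCommGroup α]

/-- **Validity of the marks of a stage** relative to the readers `ψ₁, ψ₂` of its INPUT pair and the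
scale `r`: if strand `i` is displaced by at least `c_i r` across the stage then the kernel is
dominated by the sum of its strand-`i` marked variants (one of the `c_i` lines is `≥ r` long:
pigeonhole), and the same for the already-marked variants of the other strand.
[cite: Hara2008, §3.5 (picking long segments)] -/
structure MStage.Valid (nrm : α → ℝ) (r : ℝ) (ψ₁ ψ₂ : α × α → α) (S : MStage α) : Prop where
  /-- strand 1 long across the stage: `K ≤ Σ K1` -/
  mark₁ : ∀ p q, (S.c₁ : ℝ) * r ≤ nrm (S.φ₁ q - ψ₁ p) → S.K p q ≤ lksum S.K1 p q
  /-- strand 2 long across the stage: `K ≤ Σ K2` -/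
  mark₂ : ∀ p q, (S.c₂ : ℝ) * r ≤ nrm (S.φ₂ q - ψ₂ p) → S.K p q ≤ lksum S.K2 p q
  /-- strand 1 long, strand 2 already marked: `Σ K2 ≤ Σ K12` -/
  mark₁₂ : ∀ p q, (S.c₁ : ℝ) * r ≤ nrm (S.φ₁ q - ψ₁ p) → lksum S.K2 p q ≤ lksum S.K12 p q
  /-- strand 2 long, strand 1 already marked: `Σ K1 ≤ Σ K12` -/
  mark₂₁ : ∀ p q, (S.c₂ : ℝ) * r ≤ nrm (S.φ₂ q - ψ₂ p) → lksum S.K1 p q ≤ lksum S.K12 p q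

/-- Validity of a list of stages, each relative to the readers of the previous one. [cite: Hara2008, §3.5] -/
def StagesValid (nrm : α → ℝ) (r : ℝ) : (α × α → α) → (α × α → α) → List (MStage α) → Prop
  | _, _, [] => True
  | ψ₁, ψ₂, S :: Ss => S.Valid nrm r ψ₁ ψ₂ ∧ StagesValid nrm r S.φ₁ S.φ₂ Ss

/-- The readers of the last pair of a list of stages. [folklore] -/
def lastReaders : (α × α → α) → (α × α → α) → List (MStage α) → (α × α → α) × (α × α → α)
  | ψ₁, ψ₂, [] => (ψ₁, ψ₂)
  | _, _, S :: Ss => lastReaders S.φ₁ S.φ₂ Ss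

/-- Total number of strand-1 lines in a list of stages. [folklore] -/
def count₁ : List (MStage α) → ℕ
  | [] => 0
  | S :: Ss => S.c₁ + count₁ Ss

/-- Total number of strand-2 lines in a list of stages. [folklore] -/
def count₂ : List (MStage α) → ℕ
  | [] => 0
  | S :: Ss => S.c₂ + count₂ Ss

/-- The four accumulators: unmarked chain, strand-1 marked, strand-2 marked, doubly marked. [folklore] -/
structure MState (α : Type*) where
  /-- the unmarked chain -/
  M0 : α × α → ℝ≥0∞
  /-- sum of the chains with one strand-1 mark -/
  M1 : α × α → ℝ≥0∞
  /-- sum of the chains with one strand-2 mark -/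
  M2 : α × α → ℝ≥0∞
  /-- sum of the chains with one mark on each strand -/
  M12 : α × α → ℝ≥0∞

/-- One step of the run through a stage. [cite: Hara2008, §3.5] -/
def mStep (st : MState α) (S : MStage α) : MState α where
  M0 := pkVmul st.M0 S.K
  M1 := fun q => pkVmul st.M1 S.K q + pkVmul st.M0 (lksum S.K1) q
  M2 := fun q => pkVmul st.M2 S.K q + pkVmul st.M0 (lksum S.K2) q
  M12 := fun q => pkVmul st.M12 S.K q + pkVmul st.M2 (lksum S.K1) q + pkVmul st.M1 (lksum S.K2) q +
    pkVmul st.M0 (lksum S.K12) q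

/-- The run through a list of stages. [cite: Hara2008, §3.5] -/
def mRun : MState α → List (MStage α) → MState α
  | st, [] => st
  | st, S :: Ss => mRun (mStep st S) Ss

/-- **The invariant**: once strand `i` has come at least `C_i r` far (from `x₀`) at the current pair,
the unmarked accumulator is dominated by the strand-`i` marked one, and the other-strand marked
accumulator by the doubly marked one. [cite: Hara2008, §3.5] -/
structure MState.Inv (nrm : α → ℝ) (r : ℝ) (x₀ : α) (ψ₁ ψ₂ : α × α → α) (C₁ C₂ : ℕ) (st : MState α) : Prop where
  /-- strand 1 far: `M0 ≤ M1` -/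
  le₁ : ∀ p, (C₁ : ℝ) * r ≤ nrm (ψ₁ p - x₀) → st.M0 p ≤ st.M1 p
  /-- strand 2 far: `M0 ≤ M2` -/
  le₂ : ∀ p, (C₂ : ℝ) * r ≤ nrm (ψ₂ p - x₀) → st.M0 p ≤ st.M2 p
  /-- strand 1 far: `M2 ≤ M12` -/
  le₁₂ : ∀ p, (C₁ : ℝ) * r ≤ nrm (ψ₁ p - x₀) → st.M2 p ≤ st.M12 p
  /-- strand 2 far: `M1 ≤ M12` -/
  le₂₁ : ∀ p, (C₂ : ℝ) * r ≤ nrm (ψ₂ p - x₀) → st.M1 p ≤ st.M12 p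

variable {nrm : α → ℝ} (hnrm : ∀ a b : α, nrm (a + b) ≤ nrm a + nrm b)
include hnrm

/-- The pigeonhole behind the step: if the strand has come `(C + c) r` far at the output pair then
either it had come `C r` far at the input pair or the stage displacement is `≥ c r`. [cite: Hara2008, §3.5] -/
theorem far_or_long {C c : ℕ} {r : ℝ} {x₀ a b : α} (h : ((C + c : ℕ) : ℝ) * r ≤ nrm (b - x₀)) :
    (C : ℝ) * r ≤ nrm (a - x₀) ∨ (c : ℝ) * r ≤ nrm (b - a) := by
  by_contra hcon
  rw [not_or, not_le, not_le] at hcon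
  have h1 := hnrm (a - x₀) (b - a)
  rw [show a - x₀ + (b - a) = b - x₀ by abel] at h1
  have : ((C + c : ℕ) : ℝ) * r = (C : ℝ) * r + (c : ℝ) * r := by push_cast; ring
  linarith

/-- **The step preserves the invariant.** [cite: Hara2008, §3.5] -/
theorem MState.Inv.step {r : ℝ} {x₀ : α} {ψ₁ ψ₂ : α × α → α} {C₁ C₂ : ℕ} {st : MState α}
    (hst : st.Inv nrm r x₀ ψ₁ ψ₂ C₁ C₂) {S : MStage α} (hS : S.Valid nrm r ψ₁ ψ₂) :
    (mStep st S).Inv nrm r x₀ S.φ₁ S.φ₂ (C₁ + S.c₁) (C₂ + S.c₂) := by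
  refine ⟨fun q hq => ?_, fun q hq => ?_, fun q hq => ?_, fun q hq => ?_⟩
  · -- `M0' ≤ M1'`
    show ∑' p, st.M0 p * S.K p q ≤ (∑' p, st.M1 p * S.K p q) + ∑' p, st.M0 p * lksum S.K1 p q
    rw [← ENNReal.tsum_add]
    refine ENNReal.tsum_le_tsum fun p => ?_
    rcases far_or_long hnrm hq with h | h
    · exact (mul_le_mul' (hst.le₁ p h) le_rfl).trans le_self_add
    · exact (mul_le_mul' le_rfl (hS.mark₁ p q h)).trans le_add_self
  · -- `M0' ≤ M2'`
    show ∑' p, st.M0 p * S.K p q ≤ (∑' p, st.M2 p * S.K p q) + ∑' p, st.M0 p * lksum S.K2 p q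
    rw [← ENNReal.tsum_add]
    refine ENNReal.tsum_le_tsum fun p => ?_
    rcases far_or_long hnrm hq with h | h
    · exact (mul_le_mul' (hst.le₂ p h) le_rfl).trans le_self_add
    · exact (mul_le_mul' le_rfl (hS.mark₂ p q h)).trans le_add_self
  · -- `M2' ≤ M12'`
    show (∑' p, st.M2 p * S.K p q) + ∑' p, st.M0 p * lksum S.K2 p q ≤
      (∑' p, st.M12 p * S.K p q) + (∑' p, st.M2 p * lksum S.K1 p q) +
        (∑' p, st.M1 p * lksum S.K2 p q) + ∑' p, st.M0 p * lksum S.K12 p q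
    rw [← ENNReal.tsum_add, ← ENNReal.tsum_add, ← ENNReal.tsum_add, ← ENNReal.tsum_add]
    refine ENNReal.tsum_le_tsum fun p => ?_
    rcases far_or_long hnrm hq with h | h
    · -- strand 1 was already far at `p`: `M2 ≤ M12`, `M0 ≤ M1`
      calc st.M2 p * S.K p q + st.M0 p * lksum S.K2 p q
          ≤ st.M12 p * S.K p q + st.M1 p * lksum S.K2 p q :=
            add_le_add (mul_le_mul' (hst.le₁₂ p h) le_rfl) (mul_le_mul' (hst.le₁ p h) le_rfl)
        _ ≤ _ := by
            rw [add_assoc, add_assoc]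
            exact add_le_add le_rfl (le_add_self.trans (add_le_add le_rfl le_self_add))
    · -- the strand-1 displacement across the stage is long: `K ≤ Σ K1`, `Σ K2 ≤ Σ K12`
      calc st.M2 p * S.K p q + st.M0 p * lksum S.K2 p q
          ≤ st.M2 p * lksum S.K1 p q + st.M0 p * lksum S.K12 p q :=
            add_le_add (mul_le_mul' le_rfl (hS.mark₁ p q h)) (mul_le_mul' le_rfl (hS.mark₁₂ p q h))
        _ ≤ _ := by
            rw [add_assoc, add_assoc]
            exact le_add_self.trans (add_le_add le_rfl (add_le_add le_rfl le_add_self))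
  · -- `M1' ≤ M12'`
    show (∑' p, st.M1 p * S.K p q) + ∑' p, st.M0 p * lksum S.K1 p q ≤
      (∑' p, st.M12 p * S.K p q) + (∑' p, st.M2 p * lksum S.K1 p q) +
        (∑' p, st.M1 p * lksum S.K2 p q) + ∑' p, st.M0 p * lksum S.K12 p q
    rw [← ENNReal.tsum_add, ← ENNReal.tsum_add, ← ENNReal.tsum_add, ← ENNReal.tsum_add]
    refine ENNReal.tsum_le_tsum fun p => ?_
    rcases far_or_long hnrm hq with h | h
    · -- strand 2 was already far at `p`: `M1 ≤ M12`, `M0 ≤ M2`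
      calc st.M1 p * S.K p q + st.M0 p * lksum S.K1 p q
          ≤ st.M12 p * S.K p q + st.M2 p * lksum S.K1 p q :=
            add_le_add (mul_le_mul' (hst.le₂₁ p h) le_rfl) (mul_le_mul' (hst.le₂ p h) le_rfl)
        _ ≤ _ := by
            rw [add_assoc, add_assoc]
            exact add_le_add le_rfl le_self_add
    · -- the strand-2 displacement across the stage is long: `K ≤ Σ K2`, `Σ K1 ≤ Σ K12`
      calc st.M1 p * S.K p q + st.M0 p * lksum S.K1 p q
          ≤ st.M1 p * lksum S.K2 p q + st.M0 p * lksum S.K12 p q :=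
            add_le_add (mul_le_mul' le_rfl (hS.mark₂ p q h)) (mul_le_mul' le_rfl (hS.mark₂₁ p q h))
        _ ≤ _ := by
            rw [add_assoc, add_assoc]
            exact le_add_self.trans (add_le_add le_rfl le_add_self)

/-- **The run preserves the invariant** (induction along the chain). [cite: Hara2008, §3.5] -/
theorem MState.Inv.run {r : ℝ} {x₀ : α} :
    ∀ (Ss : List (MStage α)) {ψ₁ ψ₂ : α × α → α} {C₁ C₂ : ℕ} {st : MState α},
      st.Inv nrm r x₀ ψ₁ ψ₂ C₁ C₂ → StagesValid nrm r ψ₁ ψ₂ Ss →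
      (mRun st Ss).Inv nrm r x₀ (lastReaders ψ₁ ψ₂ Ss).1 (lastReaders ψ₁ ψ₂ Ss).2
        (C₁ + count₁ Ss) (C₂ + count₂ Ss)
  | [], _, _, _, _, _, hst, _ => by simpa [mRun, lastReaders, count₁, count₂] using hst
  | S :: Ss, ψ₁, ψ₂, C₁, C₂, st, hst, hval => by
    have h := MState.Inv.run Ss (hst.step hnrm hval.1) hval.2
    simp only [mRun, lastReaders, count₁, count₂]
    rw [← add_assoc, ← add_assoc]
    exact h

/-- **The end of the chain**: with end vectors `e ≤ e1` (strand-1 line into `x` long), `e ≤ e2`,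
`e1 ≤ e12` under the corresponding length conditions (the fourth comparison `e2 ≤ e12` is not
needed: the cases are taken in order), and both strands displaced by at least (total count) `· r`
between `x₀` and `x`, the unmarked chain closed by `e` is at most the sum of the doubly marked
terms. [cite: Hara2008, §3.5 ("two factors of G_{x,N}")] -/
theorem tsum_M0_mul_le_of_inv {r : ℝ} {x₀ x : α} {ψ₁ ψ₂ : α × α → α} {C₁ C₂ ce₁ ce₂ : ℕ} {st : MState α}
    (hst : st.Inv nrm r x₀ ψ₁ ψ₂ C₁ C₂) {e e1 e2 e12 : α × α → ℝ≥0∞}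
    (he₁ : ∀ p, (ce₁ : ℝ) * r ≤ nrm (x - ψ₁ p) → e p ≤ e1 p)
    (he₂ : ∀ p, (ce₂ : ℝ) * r ≤ nrm (x - ψ₂ p) → e p ≤ e2 p)
    (he₂₁ : ∀ p, (ce₂ : ℝ) * r ≤ nrm (x - ψ₂ p) → e1 p ≤ e12 p)
    (hx₁ : ((C₁ + ce₁ : ℕ) : ℝ) * r ≤ nrm (x - x₀)) (hx₂ : ((C₂ + ce₂ : ℕ) : ℝ) * r ≤ nrm (x - x₀)) :
    ∑' p, st.M0 p * e p ≤
      ∑' p, (st.M12 p * e p + st.M2 p * e1 p + st.M1 p * e2 p + st.M0 p * e12 p) := by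
  refine ENNReal.tsum_le_tsum fun p => ?_
  rcases far_or_long hnrm (a := ψ₁ p) hx₁ with h₁ | h₁ <;>
    rcases far_or_long hnrm (a := ψ₂ p) hx₂ with h₂ | h₂
  · -- both strands far at `p`: `M0 ≤ M1 ≤ M12`
    calc st.M0 p * e p ≤ st.M12 p * e p :=
          mul_le_mul' ((hst.le₁ p h₁).trans (hst.le₂₁ p h₂)) le_rfl
      _ ≤ _ := le_self_add.trans (le_self_add.trans le_self_add)
  · -- strand 1 far, strand-2 end line long: `M0 ≤ M1`, `e ≤ e2`
    calc st.M0 p * e p ≤ st.M1 p * e2 p := mul_le_mul' (hst.le₁ p h₁) (he₂ p h₂)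
      _ ≤ _ := le_add_self.trans le_self_add
  · -- strand-1 end line long, strand 2 far: `M0 ≤ M2`, `e ≤ e1`
    calc st.M0 p * e p ≤ st.M2 p * e1 p := mul_le_mul' (hst.le₂ p h₂) (he₁ p h₁)
      _ ≤ _ := le_add_self.trans (le_self_add.trans le_self_add)
  · -- both end lines long: `e ≤ e1 ≤ e12`
    calc st.M0 p * e p ≤ st.M0 p * e12 p := mul_le_mul' le_rfl ((he₁ p h₁).trans (he₂₁ p h₂))
      _ ≤ _ := le_add_self

omit [AddCommGroup α] hnrm in
/-- `Σ_p M0 e ≤ …` split into four sums. [folklore] -/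
theorem tsum_four_split (st : MState α) (e e1 e2 e12 : α × α → ℝ≥0∞) :
    ∑' p, (st.M12 p * e p + st.M2 p * e1 p + st.M1 p * e2 p + st.M0 p * e12 p) =
      (∑' p, st.M12 p * e p) + (∑' p, st.M2 p * e1 p) + (∑' p, st.M1 p * e2 p) + ∑' p, st.M0 p * e12 p := by
  rw [ENNReal.tsum_add, ENNReal.tsum_add, ENNReal.tsum_add]

/-- **The two-long-lines insertion** for a full chain `v X₁ ⋯ X_M e`: starting accumulators
`(v, v1, v2, v12)` valid at the start (`x₀`), valid stages, valid end vectors, and both strands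
displaced by at least (total count) `· r`:
`Σ_p (v X₁⋯X_M)(p) e(p) ≤ Σ_p [M12 e + M2 e1 + M1 e2 + M0 e12](p)` for the final accumulators.
[cite: Hara2008, §3.5 ("we just bound the diagram by extracting two factors of G_{x,N}")] -/
theorem tsum_M0_mul_le {r : ℝ} {x₀ x : α} {φ₁ φ₂ : α × α → α} {c₁ c₂ ce₁ ce₂ : ℕ} {st₀ : MState α}
    (hst₀ : st₀.Inv nrm r x₀ φ₁ φ₂ c₁ c₂) (Ss : List (MStage α)) (hval : StagesValid nrm r φ₁ φ₂ Ss)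
    {e e1 e2 e12 : α × α → ℝ≥0∞}
    (he₁ : ∀ p, (ce₁ : ℝ) * r ≤ nrm (x - (lastReaders φ₁ φ₂ Ss).1 p) → e p ≤ e1 p)
    (he₂ : ∀ p, (ce₂ : ℝ) * r ≤ nrm (x - (lastReaders φ₁ φ₂ Ss).2 p) → e p ≤ e2 p)
    (he₂₁ : ∀ p, (ce₂ : ℝ) * r ≤ nrm (x - (lastReaders φ₁ φ₂ Ss).2 p) → e1 p ≤ e12 p)
    (hx₁ : ((c₁ + count₁ Ss + ce₁ : ℕ) : ℝ) * r ≤ nrm (x - x₀))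
    (hx₂ : ((c₂ + count₂ Ss + ce₂ : ℕ) : ℝ) * r ≤ nrm (x - x₀)) :
    ∑' p, (mRun st₀ Ss).M0 p * e p ≤
      (∑' p, (mRun st₀ Ss).M12 p * e p) + (∑' p, (mRun st₀ Ss).M2 p * e1 p) +
        (∑' p, (mRun st₀ Ss).M1 p * e2 p) + ∑' p, (mRun st₀ Ss).M0 p * e12 p := by
  rw [← tsum_four_split]
  exact tsum_M0_mul_le_of_inv hnrm (hst₀.run hnrm Ss hval) he₁ he₂ he₂₁ hx₁ hx₂

omit hnrm in
/-- The trivial start of the invariant: with `C₁ = C₂ = 0`... rather, the start accumulators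
`(v, v1, v2, v12)` are valid with counts `c₁, c₂` when `v ≤ v1` if strand 1 is displaced by `c₁ r`
from `x₀` at the first pair, etc. (a restatement of `MState.Inv` for the start vector). [folklore] -/
theorem MState.inv_start {r : ℝ} {x₀ : α} {φ₁ φ₂ : α × α → α} {c₁ c₂ : ℕ} {v v1 v2 v12 : α × α → ℝ≥0∞}
    (h₁ : ∀ p, (c₁ : ℝ) * r ≤ nrm (φ₁ p - x₀) → v p ≤ v1 p)
    (h₂ : ∀ p, (c₂ : ℝ) * r ≤ nrm (φ₂ p - x₀) → v p ≤ v2 p)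
    (h₁₂ : ∀ p, (c₁ : ℝ) * r ≤ nrm (φ₁ p - x₀) → v2 p ≤ v12 p)
    (h₂₁ : ∀ p, (c₂ : ℝ) * r ≤ nrm (φ₂ p - x₀) → v1 p ≤ v12 p) :
    (⟨v, v1, v2, v12⟩ : MState α).Inv nrm r x₀ φ₁ φ₂ c₁ c₂ :=
  ⟨h₁, h₂, h₁₂, h₂₁⟩

end Run

/-! ### The accumulators as explicit sums of marked chains -/

/-- The kernels of a list of stages. [folklore] -/
def kernels (Ss : List (MStage α)) : List (α × α → α × α → ℝ≥0∞) := Ss.map MStage.K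

/-- Unfolding of `kernels` on `cons`. [folklore] -/
@[simp] theorem kernels_cons (S : MStage α) (Ss : List (MStage α)) : kernels (S :: Ss) = S.K :: kernels Ss := rfl

/-- Unfolding of `kernels` on `nil`. [folklore] -/
@[simp] theorem kernels_nil : kernels ([] : List (MStage α)) = [] := rfl

/-- The chains with exactly one strand-1 marked kernel, started from `w`. [cite: Hara2008, §3.5] -/
def L1 : (α × α → ℝ≥0∞) → List (MStage α) → List (α × α → ℝ≥0∞)
  | _, [] => []
  | w, S :: Ss => (S.K1.map fun M => pkChainL (pkVmul w M) (kernels Ss)) ++ L1 (pkVmul w S.K) Ss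

/-- The chains with exactly one strand-2 marked kernel, started from `w`. [cite: Hara2008, §3.5] -/
def L2 : (α × α → ℝ≥0∞) → List (MStage α) → List (α × α → ℝ≥0∞)
  | _, [] => []
  | w, S :: Ss => (S.K2.map fun M => pkChainL (pkVmul w M) (kernels Ss)) ++ L2 (pkVmul w S.K) Ss

/-- The chains with one strand-1 and one strand-2 mark (possibly in the same stage), started from `w`.
[cite: Hara2008, §3.5 ("(2N+1)² choices")] -/
def L12 : (α × α → ℝ≥0∞) → List (MStage α) → List (α × α → ℝ≥0∞)
  | _, [] => []
  | w, S :: Ss => (S.K12.map fun M => pkChainL (pkVmul w M) (kernels Ss)) ++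
      ((S.K1.flatMap fun M => L2 (pkVmul w M) Ss) ++
        ((S.K2.flatMap fun M => L1 (pkVmul w M) Ss) ++ L12 (pkVmul w S.K) Ss))

section Expand

/-- `M0` of the run is the unmarked chain. [folklore] -/
theorem mRun_M0_eq : ∀ (Ss : List (MStage α)) (st : MState α), (mRun st Ss).M0 = pkChainL st.M0 (kernels Ss)
  | [], _ => rfl
  | S :: Ss, st => by rw [mRun, mRun_M0_eq Ss]; rfl

/-- `M1` of the run: the propagated start `M1` plus the chains with one strand-1 mark. [folklore] -/
theorem mRun_M1_eq : ∀ (Ss : List (MStage α)) (st : MState α),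
    (mRun st Ss).M1 = fun q => pkChainL st.M1 (kernels Ss) q + lvsum (L1 st.M0 Ss) q
  | [], _ => by funext q; simp [mRun, L1, lvsum]
  | S :: Ss, st => by
    rw [mRun, mRun_M1_eq Ss]
    funext q
    simp only [mStep, kernels_cons, pkChainL_cons, L1, lvsum_append]
    rw [pkChainL_add, pkVmul_lksum, pkChainL_lvsum, List.map_map]
    simp only [Function.comp_def]
    ring

/-- `M2` of the run: the propagated start `M2` plus the chains with one strand-2 mark. [folklore] -/
theorem mRun_M2_eq : ∀ (Ss : List (MStage α)) (st : MState α),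
    (mRun st Ss).M2 = fun q => pkChainL st.M2 (kernels Ss) q + lvsum (L2 st.M0 Ss) q
  | [], _ => by funext q; simp [mRun, L2, lvsum]
  | S :: Ss, st => by
    rw [mRun, mRun_M2_eq Ss]
    funext q
    simp only [mStep, kernels_cons, pkChainL_cons, L2, lvsum_append]
    rw [pkChainL_add, pkVmul_lksum, pkChainL_lvsum, List.map_map]
    simp only [Function.comp_def]
    ring

/-- `lvsum` of a `flatMap`. [folklore] -/
theorem lvsum_flatMap {β : Type*} (L : List β) (F : β → List (α × α → ℝ≥0∞)) (q : α × α) :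
    lvsum (L.flatMap F) q = (L.map fun b => lvsum (F b) q).sum := by
  induction L with
  | nil => simp [lvsum]
  | cons b L ih => rw [List.flatMap_cons, lvsum_append, ih, List.map_cons, List.sum_cons]


/-- `lvsum` of a `map` into pointwise sums. [folklore] -/
theorem lvsum_map_add {β : Type*} (L : List β) (f g : β → α × α → ℝ≥0∞) (q : α × α) :
    lvsum (L.map fun b p => f b p + g b p) q = lvsum (L.map f) q + lvsum (L.map g) q := by
  induction L with
  | nil => simp [lvsum]
  | cons b L ih =>
    simp only [List.map_cons, lvsum_cons, ih]
    ring

/-- `lvsum` of a `map` into zero vectors vanishes. [folklore] -/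
theorem lvsum_map_zero {β : Type*} (L : List β) (q : α × α) :
    lvsum (L.map fun (_ : β) (_ : α × α) => (0 : ℝ≥0∞)) q = 0 := by
  induction L with
  | nil => rfl
  | cons b L ih => rw [List.map_cons, lvsum_cons, ih, zero_add]

/-- `pkVmul` against the zero kernel. [folklore] -/
theorem pkVmul_zero_kernel (u : α × α → ℝ≥0∞) :
    pkVmul u (fun (_ : α × α) (_ : α × α) => (0 : ℝ≥0∞)) = fun _ => 0 := by
  funext q; simp [pkVmul]

/-- `L1` of the zero start vector sums to zero. [folklore] -/
theorem lvsum_L1_zero : ∀ (Ss : List (MStage α)) (q : α × α), lvsum (L1 (fun _ => (0 : ℝ≥0∞)) Ss) q = 0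
  | [], _ => rfl
  | S :: Ss, q => by
    simp only [L1, lvsum_append, pkVmul_zero, pkChainL_zero]
    rw [lvsum_map_zero, lvsum_L1_zero Ss q, zero_add]

/-- `L2` of the zero start vector sums to zero. [folklore] -/
theorem lvsum_L2_zero : ∀ (Ss : List (MStage α)) (q : α × α), lvsum (L2 (fun _ => (0 : ℝ≥0∞)) Ss) q = 0
  | [], _ => rfl
  | S :: Ss, q => by
    simp only [L2, lvsum_append, pkVmul_zero, pkChainL_zero]
    rw [lvsum_map_zero, lvsum_L2_zero Ss q, zero_add]

/-- `L1` is additive in the start vector (as a sum). [folklore] -/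
theorem lvsum_L1_add : ∀ (Ss : List (MStage α)) (u u' : α × α → ℝ≥0∞) (q : α × α),
    lvsum (L1 (fun p => u p + u' p) Ss) q = lvsum (L1 u Ss) q + lvsum (L1 u' Ss) q
  | [], _, _, _ => by simp [L1, lvsum]
  | S :: Ss, u, u', q => by
    simp only [L1, lvsum_append]
    rw [pkVmul_add u u' S.K, lvsum_L1_add Ss (pkVmul u S.K) (pkVmul u' S.K) q]
    have hmap : (S.K1.map fun M => pkChainL (pkVmul (fun p => u p + u' p) M) (kernels Ss)) =
        S.K1.map fun M p => pkChainL (pkVmul u M) (kernels Ss) p + pkChainL (pkVmul u' M) (kernels Ss) p := by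
      refine List.map_congr_left fun M _ => ?_
      rw [pkVmul_add u u' M, pkChainL_add]
    rw [hmap, lvsum_map_add]
    ring

/-- `L2` is additive in the start vector (as a sum). [folklore] -/
theorem lvsum_L2_add : ∀ (Ss : List (MStage α)) (u u' : α × α → ℝ≥0∞) (q : α × α),
    lvsum (L2 (fun p => u p + u' p) Ss) q = lvsum (L2 u Ss) q + lvsum (L2 u' Ss) q
  | [], _, _, _ => by simp [L2, lvsum]
  | S :: Ss, u, u', q => by
    simp only [L2, lvsum_append]
    rw [pkVmul_add u u' S.K, lvsum_L2_add Ss (pkVmul u S.K) (pkVmul u' S.K) q]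
    have hmap : (S.K2.map fun M => pkChainL (pkVmul (fun p => u p + u' p) M) (kernels Ss)) =
        S.K2.map fun M p => pkChainL (pkVmul u M) (kernels Ss) p + pkChainL (pkVmul u' M) (kernels Ss) p := by
      refine List.map_congr_left fun M _ => ?_
      rw [pkVmul_add u u' M, pkChainL_add]
    rw [hmap, lvsum_map_add]
    ring

/-- `L1` started from `w (Σ K)` is the sum over `K` of `L1` started from `w K`. [folklore] -/
theorem lvsum_L1_lksum (w : α × α → ℝ≥0∞) (Ss : List (MStage α)) (q : α × α) :
    ∀ Ks : List (α × α → α × α → ℝ≥0∞),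
      lvsum (L1 (pkVmul w (lksum Ks)) Ss) q = (Ks.map fun M => lvsum (L1 (pkVmul w M) Ss) q).sum
  | [] => by
    have h0 : lksum ([] : List (α × α → α × α → ℝ≥0∞)) = fun _ _ => 0 := rfl
    rw [h0, pkVmul_zero_kernel, lvsum_L1_zero, List.map_nil, List.sum_nil]
  | M :: Ks => by
    have hc : lksum (M :: Ks) = fun p q => M p q + lksum Ks p q := rfl
    rw [hc, pkVmul_add_kernel, lvsum_L1_add, lvsum_L1_lksum w Ss q Ks, List.map_cons, List.sum_cons]

/-- `L2` started from `w (Σ K)` is the sum over `K` of `L2` started from `w K`. [folklore] -/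
theorem lvsum_L2_lksum (w : α × α → ℝ≥0∞) (Ss : List (MStage α)) (q : α × α) :
    ∀ Ks : List (α × α → α × α → ℝ≥0∞),
      lvsum (L2 (pkVmul w (lksum Ks)) Ss) q = (Ks.map fun M => lvsum (L2 (pkVmul w M) Ss) q).sum
  | [] => by
    have h0 : lksum ([] : List (α × α → α × α → ℝ≥0∞)) = fun _ _ => 0 := rfl
    rw [h0, pkVmul_zero_kernel, lvsum_L2_zero, List.map_nil, List.sum_nil]
  | M :: Ks => by
    have hc : lksum (M :: Ks) = fun p q => M p q + lksum Ks p q := rfl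
    rw [hc, pkVmul_add_kernel, lvsum_L2_add, lvsum_L2_lksum w Ss q Ks, List.map_cons, List.sum_cons]

/-- `M12` of the run: the propagated start `M12`, the start `M2` with a later strand-1 mark, the
start `M1` with a later strand-2 mark, and the chains with both marks. [folklore] -/
theorem mRun_M12_eq : ∀ (Ss : List (MStage α)) (st : MState α),
    (mRun st Ss).M12 = fun q => pkChainL st.M12 (kernels Ss) q + lvsum (L1 st.M2 Ss) q +
      lvsum (L2 st.M1 Ss) q + lvsum (L12 st.M0 Ss) q
  | [], _ => by funext q; simp [mRun, L1, L2, L12, lvsum]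
  | S :: Ss, st => by
    rw [mRun, mRun_M12_eq Ss]
    funext q
    simp only [mStep, kernels_cons, pkChainL_cons, L1, L2, L12, lvsum_append, lvsum_flatMap]
    rw [lvsum_L1_add Ss (pkVmul st.M2 S.K) (pkVmul st.M0 (lksum S.K2)) q,
      lvsum_L2_add Ss (pkVmul st.M1 S.K) (pkVmul st.M0 (lksum S.K1)) q,
      lvsum_L1_lksum, lvsum_L2_lksum]
    have h12 : pkChainL (fun q => pkVmul st.M12 S.K q + pkVmul st.M2 (lksum S.K1) q +
          pkVmul st.M1 (lksum S.K2) q + pkVmul st.M0 (lksum S.K12) q) (kernels Ss) q =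
        pkChainL (pkVmul st.M12 S.K) (kernels Ss) q +
          lvsum (S.K1.map fun M => pkChainL (pkVmul st.M2 M) (kernels Ss)) q +
          lvsum (S.K2.map fun M => pkChainL (pkVmul st.M1 M) (kernels Ss)) q +
          lvsum (S.K12.map fun M => pkChainL (pkVmul st.M0 M) (kernels Ss)) q := by
      rw [pkChainL_add (fun q => pkVmul st.M12 S.K q + pkVmul st.M2 (lksum S.K1) q +
          pkVmul st.M1 (lksum S.K2) q) (pkVmul st.M0 (lksum S.K12)),
        pkChainL_add (fun q => pkVmul st.M12 S.K q + pkVmul st.M2 (lksum S.K1) q) (pkVmul st.M1 (lksum S.K2)),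
        pkChainL_add (pkVmul st.M12 S.K) (pkVmul st.M2 (lksum S.K1))]
      simp only [pkVmul_lksum, pkChainL_lvsum, List.map_map, Function.comp_def]
    rw [h12]
    ring

/-! ### Which chains occur: marks at given positions -/

/-- A member of `L1 w Ss` is the chain with the kernel at some position `j` replaced by one of its
strand-1 marked variants. [cite: Hara2008, §3.5] -/
theorem mem_L1 : ∀ (Ss : List (MStage α)) (w t : α × α → ℝ≥0∞), t ∈ L1 w Ss →
    ∃ (j : ℕ) (hj : j < Ss.length), ∃ M ∈ (Ss.get ⟨j, hj⟩).K1, t = pkChainL w ((kernels Ss).set j M)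
  | [], _, _, h => by simp [L1] at h
  | S :: Ss, w, t, h => by
    simp only [L1, List.mem_append, List.mem_map] at h
    rcases h with ⟨M, hM, rfl⟩ | h
    · exact ⟨0, by simp, M, hM, rfl⟩
    · obtain ⟨j, hj, M, hM, rfl⟩ := mem_L1 Ss _ _ h
      exact ⟨j + 1, by simpa using hj, M, hM, rfl⟩

/-- A member of `L2 w Ss` is the chain with the kernel at some position `j` replaced by one of its
strand-2 marked variants. [cite: Hara2008, §3.5] -/
theorem mem_L2 : ∀ (Ss : List (MStage α)) (w t : α × α → ℝ≥0∞), t ∈ L2 w Ss →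
    ∃ (j : ℕ) (hj : j < Ss.length), ∃ M ∈ (Ss.get ⟨j, hj⟩).K2, t = pkChainL w ((kernels Ss).set j M)
  | [], _, _, h => by simp [L2] at h
  | S :: Ss, w, t, h => by
    simp only [L2, List.mem_append, List.mem_map] at h
    rcases h with ⟨M, hM, rfl⟩ | h
    · exact ⟨0, by simp, M, hM, rfl⟩
    · obtain ⟨j, hj, M, hM, rfl⟩ := mem_L2 Ss _ _ h
      exact ⟨j + 1, by simpa using hj, M, hM, rfl⟩

/-- A member of `L12 w Ss` is the chain with the kernel at one position replaced by a doubly marked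
variant, or with the kernels at two positions `j < l` replaced by a strand-1 (resp. strand-2)
marked variant at `j` and a strand-2 (resp. strand-1) marked variant at `l`.
[cite: Hara2008, §3.5 ("(2N+1)² choices")] -/
theorem mem_L12 : ∀ (Ss : List (MStage α)) (w t : α × α → ℝ≥0∞), t ∈ L12 w Ss →
    (∃ (j : ℕ) (hj : j < Ss.length), ∃ M ∈ (Ss.get ⟨j, hj⟩).K12, t = pkChainL w ((kernels Ss).set j M)) ∨
    (∃ (j l : ℕ) (hj : j < Ss.length) (hl : l < Ss.length), j < l ∧
      ((∃ M ∈ (Ss.get ⟨j, hj⟩).K1, ∃ M' ∈ (Ss.get ⟨l, hl⟩).K2,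
          t = pkChainL w (((kernels Ss).set j M).set l M')) ∨
       (∃ M ∈ (Ss.get ⟨j, hj⟩).K2, ∃ M' ∈ (Ss.get ⟨l, hl⟩).K1,
          t = pkChainL w (((kernels Ss).set j M).set l M'))))
  | [], _, _, h => by simp [L12] at h
  | S :: Ss, w, t, h => by
    simp only [L12, List.mem_append, List.mem_map, List.mem_flatMap] at h
    rcases h with ⟨M, hM, rfl⟩ | ⟨M, hM, h⟩ | ⟨M, hM, h⟩ | h
    · exact Or.inl ⟨0, by simp, M, hM, rfl⟩
    · obtain ⟨l, hl, M', hM', rfl⟩ := mem_L2 Ss _ _ h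
      exact Or.inr ⟨0, l + 1, by simp, by simpa using hl, by omega, Or.inl ⟨M, hM, M', hM', rfl⟩⟩
    · obtain ⟨l, hl, M', hM', rfl⟩ := mem_L1 Ss _ _ h
      exact Or.inr ⟨0, l + 1, by simp, by simpa using hl, by omega, Or.inr ⟨M, hM, M', hM', rfl⟩⟩
    · rcases mem_L12 Ss _ _ h with ⟨j, hj, M, hM, rfl⟩ | ⟨j, l, hj, hl, hjl, hh⟩
      · exact Or.inl ⟨j + 1, by simpa using hj, M, hM, rfl⟩
      · refine Or.inr ⟨j + 1, l + 1, by simpa using hj, by simpa using hl, by omega, ?_⟩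
        rcases hh with ⟨M, hM, M', hM', rfl⟩ | ⟨M, hM, M', hM', rfl⟩
        · exact Or.inl ⟨M, hM, M', hM', rfl⟩
        · exact Or.inr ⟨M, hM, M', hM', rfl⟩

/-! ### How many chains occur -/

/-- `|L1 w Ss| ≤ m |Ss|` if every stage has at most `m` strand-1 variants. [cite: Hara2008, §3.5] -/
theorem length_L1_le {m : ℕ} : ∀ (Ss : List (MStage α)) (w : α × α → ℝ≥0∞),
    (∀ S ∈ Ss, S.K1.length ≤ m) → (L1 w Ss).length ≤ m * Ss.length
  | [], _, _ => by simp [L1]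
  | S :: Ss, w, h => by
    simp only [L1, List.length_append, List.length_map, List.length_cons]
    have h1 := h S (by simp)
    have h2 := length_L1_le Ss (pkVmul w S.K) fun S' hS' => h S' (by simp [hS'])
    nlinarith

/-- `|L2 w Ss| ≤ m |Ss|` if every stage has at most `m` strand-2 variants. [cite: Hara2008, §3.5] -/
theorem length_L2_le {m : ℕ} : ∀ (Ss : List (MStage α)) (w : α × α → ℝ≥0∞),
    (∀ S ∈ Ss, S.K2.length ≤ m) → (L2 w Ss).length ≤ m * Ss.length
  | [], _, _ => by simp [L2]
  | S :: Ss, w, h => by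
    simp only [L2, List.length_append, List.length_map, List.length_cons]
    have h1 := h S (by simp)
    have h2 := length_L2_le Ss (pkVmul w S.K) fun S' hS' => h S' (by simp [hS'])
    nlinarith

/-- `Σ` of the lengths of a `flatMap`. [folklore] -/
theorem length_flatMap_le {β γ : Type*} (L : List β) (F : β → List γ) {B : ℕ} (h : ∀ b ∈ L, (F b).length ≤ B) :
    (L.flatMap F).length ≤ L.length * B := by
  induction L with
  | nil => simp
  | cons b L ih =>
    rw [List.flatMap_cons, List.length_append, List.length_cons]
    have h1 := h b (by simp)
    have h2 := ih fun b' hb' => h b' (by simp [hb'])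
    nlinarith

/-- **`O(M²)` choices**: `|L12 w Ss| ≤ m |Ss| + 2 m² |Ss|²` if every stage has at most `m` variants
of each kind ("the total number of choices are bounded by `(2N+1)²`"). [cite: Hara2008, §3.5] -/
theorem length_L12_le {m : ℕ} : ∀ (Ss : List (MStage α)) (w : α × α → ℝ≥0∞),
    (∀ S ∈ Ss, S.K1.length ≤ m ∧ S.K2.length ≤ m ∧ S.K12.length ≤ m) →
    (L12 w Ss).length ≤ m * Ss.length + 2 * m ^ 2 * Ss.length ^ 2
  | [], _, _ => by simp [L12]
  | S :: Ss, w, h => by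
    simp only [L12, List.length_append, List.length_map, List.length_cons]
    obtain ⟨hK1, hK2, hK12⟩ := h S (by simp)
    have hSs : ∀ S' ∈ Ss, S'.K1.length ≤ m ∧ S'.K2.length ≤ m ∧ S'.K12.length ≤ m :=
      fun S' hS' => h S' (by simp [hS'])
    have hA : (S.K1.flatMap fun M => L2 (pkVmul w M) Ss).length ≤ S.K1.length * (m * Ss.length) :=
      length_flatMap_le _ _ fun M _ => length_L2_le Ss _ fun S' hS' => (hSs S' hS').2.1
    have hB : (S.K2.flatMap fun M => L1 (pkVmul w M) Ss).length ≤ S.K2.length * (m * Ss.length) :=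
      length_flatMap_le _ _ fun M _ => length_L1_le Ss _ fun S' hS' => (hSs S' hS').1
    have hC := length_L12_le Ss (pkVmul w S.K) hSs
    have hA' : (S.K1.flatMap fun M => L2 (pkVmul w M) Ss).length ≤ m * (m * Ss.length) :=
      hA.trans (Nat.mul_le_mul_right _ hK1)
    have hB' : (S.K2.flatMap fun M => L1 (pkVmul w M) Ss).length ≤ m * (m * Ss.length) :=
      hB.trans (Nat.mul_le_mul_right _ hK2)
    nlinarith

end Expand

end Literature.Barriers.CriticalPhenomena
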